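import Mathlib
import Literature.Analysis.FluidPDE.TaoCascadeODE
import HarnessLib

/-!
# `SubcriticalEnvelope.ForwardSourceTailEnvelope` (stmt-NavierStokesRegularity-26373) — LINEAR
RE-DRESSING TRANSFER for honest viscous lattice solutions (helper file, `--supports`)

Context (KEY-NS #103/#105, critic idea-crit-3 RE-RULE 2026-08-28T08:35:05Z, structural negative
of prover-ns-ow-p1-g4): the forward-source cruxes of the TL-M2Break cluster quantify over table
classes that are closed under flux-preserving RE-DRESSINGS (splitting a mode `p : q`, differential
feeds `(p x_a − q x_b)²` with a symmetric back-reaction split).  A re-dressing is a pair of tables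
`α`, `α̃` and a real `m × m` matrix `L` such that the cascade nonlinearity INTERTWINES along the
linear mode map `X̃_{i,k} = Σ_j L_{ij} X_{j,k}`:
`quadTerm ε₀ α̃ X̃ i k t = Σ_j L_{ij} · quadTerm ε₀ α X j k t`.
This file proves, once and for all tables, that under such an identity on a window `[0, s]` the
mapped family `X̃` inherits EVERY hypothesis the crux binders place on a solution — the five
«honesty» clauses of `ForwardSourceTailEnvelope` / `ViscousTailEnvelope` / `ForwardTailCeiling` /
`CeilingAt` / `ForwardHopWake`:

* `redress_init`     — one-shell initial datum, with the mapped datum `X̃₀ = L X₀`;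
* `redress_noLow`    — no amplitudes below the datum shell;
* `redress_bound`    — the (4.5)-weighted a-priori bound (constant `(Σ_{ij}|L_{ij}|)·|M|`);
* `redress_continuous` — continuity of every amplitude;
* `redress_ode`      — the exact `ν`-viscous equation of motion as `HasDerivWithinAt` on
  `Icc 0 s` (the damping `−ν(1+ε₀)^{2k}X_{i,k}` is diagonal and shell-wise, so it commutes with
  any mode map);

plus two generic facts used by the re-dressing arguments:

* `quadTerm_eq_zero_of_coeff_target` — a component into which no structure constant points has
  vanishing cascade nonlinearity;
* `sq_le_sq_init_of_damped` — an amplitude driven only by its own damping `y' = −c·y`, `c ≥ 0`,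
  on `[0, s]` does not grow in energy: `y(t)² ≤ y(0)²`.

With these, «new crux AS TYPED ⇒ old body on the witness table» (twin-`α_SB`, twin-`T₁₀`)
reduces to ONE algebraic intertwining identity per witness (sibling file
`SubcriticalEnvelopeForwardSourceTailEnvelopeSideBranch.lean`) — this is the kernel form of the
critic's standing probe BC8 «surgery invariance».

HONEST FRAMING: elementary calculus/algebra about Tao-type MODEL lattice ODEs (route
SubcriticalEnvelope, rung TL-M2Break); no crux is proved or refuted here; nothing in this file is a
statement about the Navier–Stokes equations, and NS regularity is NOT advanced by it.
-/

noncomputable section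

-- the sub-problem namespace `NavierStokesRegularity.NavierStokesRegularity` is the tree's layout (D-0017)
set_option linter.dupNamespace false

namespace Summit.NavierStokesRegularity.NavierStokesRegularity.Theorems

open Set
open Literature.Analysis.FluidPDE.TaoCascade

section Redressing

variable {m : ℕ} {ε₀ : ℝ}
  {L : Fin m → Fin m → ℝ} {X Xt : Fin m → ℤ → ℝ → ℝ} {X₀ Xt₀ : Fin m → ℝ}

/-- **Re-dressing keeps the one-shell initial condition.** If `X` starts from the one-shell datum
`X₀` at shell `0` and `X̃ = L·X` mode-wise, then `X̃` starts from the one-shell datum `L·X₀`.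
MODEL lattice bookkeeping. [this file] -/
theorem redress_init (hXt : ∀ i k t, Xt i k t = ∑ j, L i j * X j k t)
    (hXt₀ : ∀ i, Xt₀ i = ∑ j, L i j * X₀ j)
    (hinit : ∀ i k, X i k 0 = if k = 0 then X₀ i else 0) :
    ∀ i k, Xt i k 0 = if k = 0 then Xt₀ i else 0 := by
  intro i k
  rw [hXt]
  split_ifs with hk
  · rw [hXt₀]
    exact Finset.sum_congr rfl fun j _ => by rw [hinit, if_pos hk]
  · exact Finset.sum_eq_zero fun j _ => by rw [hinit, if_neg hk, mul_zero]

/-- **Re-dressing keeps «no very low frequencies».** MODEL lattice bookkeeping. [this file] -/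
theorem redress_noLow (hXt : ∀ i k t, Xt i k t = ∑ j, L i j * X j k t)
    (hlow : ∀ i k, k < 0 → ∀ t, X i k t = 0) :
    ∀ i k, k < 0 → ∀ t, Xt i k t = 0 := by
  intro i k hk t
  rw [hXt]
  exact Finset.sum_eq_zero fun j _ => by rw [hlow j k hk t, mul_zero]

/-- **Re-dressing keeps the (4.5)-weighted a-priori bound**, with constant `(Σ_{i,j} |L_{ij}|)·|M|`.
MODEL lattice bookkeeping. [this file] -/
theorem redress_bound (hXt : ∀ i k t, Xt i k t = ∑ j, L i j * X j k t)
    (hbd : ∃ M : ℝ, ∀ (t : ℝ) (i : Fin m) (k : ℤ), (1 + (1 + ε₀) ^ ((10 : ℝ) * k)) * |X i k t| ≤ M) :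
    ∃ M : ℝ, ∀ (t : ℝ) (i : Fin m) (k : ℤ), (1 + (1 + ε₀) ^ ((10 : ℝ) * k)) * |Xt i k t| ≤ M := by
  obtain ⟨M, hM⟩ := hbd
  refine ⟨(∑ i, ∑ j, |L i j|) * |M|, fun t i k => ?_⟩
  have hS : (∑ j, |L i j|) * |M| ≤ (∑ i, ∑ j, |L i j|) * |M| := by
    apply mul_le_mul_of_nonneg_right _ (abs_nonneg M)
    exact Finset.single_le_sum (f := fun i => ∑ j, |L i j|)
      (fun i _ => Finset.sum_nonneg fun j _ => abs_nonneg _) (Finset.mem_univ i)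
  rcases le_or_gt (1 + (1 + ε₀) ^ ((10 : ℝ) * k)) 0 with hw | hw
  · calc (1 + (1 + ε₀) ^ ((10 : ℝ) * k)) * |Xt i k t| ≤ 0 :=
          mul_nonpos_of_nonpos_of_nonneg hw (abs_nonneg _)
      _ ≤ (∑ i, ∑ j, |L i j|) * |M| := by positivity
  · calc (1 + (1 + ε₀) ^ ((10 : ℝ) * k)) * |Xt i k t|
          ≤ (1 + (1 + ε₀) ^ ((10 : ℝ) * k)) * ∑ j, |L i j| * |X j k t| := by
            rw [hXt]
            apply mul_le_mul_of_nonneg_left _ hw.le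
            refine (Finset.abs_sum_le_sum_abs _ _).trans (le_of_eq ?_)
            exact Finset.sum_congr rfl fun j _ => abs_mul _ _
      _ = ∑ j, |L i j| * ((1 + (1 + ε₀) ^ ((10 : ℝ) * k)) * |X j k t|) := by
            rw [Finset.mul_sum]
            exact Finset.sum_congr rfl fun j _ => by ring
      _ ≤ ∑ j, |L i j| * |M| :=
            Finset.sum_le_sum fun j _ =>
              mul_le_mul_of_nonneg_left ((hM t j k).trans (le_abs_self M)) (abs_nonneg _)
      _ = (∑ j, |L i j|) * |M| := by rw [Finset.sum_mul]
      _ ≤ (∑ i, ∑ j, |L i j|) * |M| := hS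

/-- **Re-dressing keeps continuity of every amplitude.** MODEL lattice bookkeeping. [this file] -/
theorem redress_continuous (hXt : ∀ i k t, Xt i k t = ∑ j, L i j * X j k t)
    (hcont : ∀ i k, Continuous (X i k)) : ∀ i k, Continuous (Xt i k) := by
  intro i k
  have h : Xt i k = fun t => ∑ j, L i j * X j k t := funext fun t => hXt i k t
  rw [h]
  exact continuous_finsetSum _ fun j _ => continuous_const.mul (hcont j k)

/-- **Re-dressing keeps the exact `ν`-viscous equation of motion** on the window `[0, s]`, given
the INTERTWINING identity `quadTerm ε₀ α̃ X̃ i k t = Σ_j L_{ij} · quadTerm ε₀ α X j k t` there (the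
damping `−ν(1+ε₀)^{2k}X_{i,k}` is diagonal and shell-wise, hence commutes with the mode map).
MODEL lattice bookkeeping. [this file] -/
theorem redress_ode {ν s : ℝ} {α αt : Fin m → Fin m → Fin m → ℤ × ℤ × ℤ → ℝ}
    (hXt : ∀ i k t, Xt i k t = ∑ j, L i j * X j k t)
    (hQ : ∀ (i : Fin m) (k : ℤ), ∀ t ∈ Icc (0 : ℝ) s,
      quadTerm ε₀ αt Xt i k t = ∑ j, L i j * quadTerm ε₀ α X j k t)
    (hode : ∀ (i : Fin m) (k : ℤ), ∀ t ∈ Icc (0 : ℝ) s, HasDerivWithinAt (X i k)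
      (quadTerm ε₀ α X i k t - ν * (1 + ε₀) ^ ((2 : ℝ) * k) * X i k t) (Icc 0 s) t) :
    ∀ (i : Fin m) (k : ℤ), ∀ t ∈ Icc (0 : ℝ) s, HasDerivWithinAt (Xt i k)
      (quadTerm ε₀ αt Xt i k t - ν * (1 + ε₀) ^ ((2 : ℝ) * k) * Xt i k t) (Icc 0 s) t := by
  intro i k t ht
  have h : Xt i k = fun t => ∑ j, L i j * X j k t := funext fun t => hXt i k t
  have hsum : HasDerivWithinAt (Xt i k)
      (∑ j, L i j * (quadTerm ε₀ α X j k t - ν * (1 + ε₀) ^ ((2 : ℝ) * k) * X j k t))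
      (Icc 0 s) t := by
    rw [h]
    exact HasDerivWithinAt.fun_sum fun j _ => (hode j k t ht).const_mul (L i j)
  refine hsum.congr_deriv ?_
  rw [hQ i k t ht, hXt i k t, Finset.mul_sum, ← Finset.sum_sub_distrib]
  exact Finset.sum_congr rfl fun j _ => by ring

/-- **A component nobody points at has no cascade nonlinearity.** If every structure constant
`α i₁ i₂ c μ` with target `c` vanishes on the shift set, then `quadTerm ε₀ α X c n t = 0`.
MODEL lattice bookkeeping. [this file] -/
theorem quadTerm_eq_zero_of_coeff_target {α : Fin m → Fin m → Fin m → ℤ × ℤ × ℤ → ℝ} {c : Fin m}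
    (h : ∀ (i₁ i₂ : Fin m), ∀ μ ∈ shiftSet, α i₁ i₂ c μ = 0)
    (X : Fin m → ℤ → ℝ → ℝ) (n : ℤ) (t : ℝ) : quadTerm ε₀ α X c n t = 0 := by
  unfold quadTerm
  exact Finset.sum_eq_zero fun i₁ _ => Finset.sum_eq_zero fun i₂ _ =>
    Finset.sum_eq_zero fun μ hμ => by rw [h i₁ i₂ μ hμ, zero_mul, zero_mul]

/-- **A purely damped amplitude does not grow in energy.** If `y' = q(t) − c·y` within `[0, s]`
with `q ≡ 0` there and `c ≥ 0` (an amplitude whose cascade nonlinearity vanishes, driven only by its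
own viscous damping), then `y(t)² ≤ y(0)²` on `[0, s]`.  Elementary calculus. [this file] -/
theorem sq_le_sq_init_of_damped {y q : ℝ → ℝ} {c s : ℝ} (hc : 0 ≤ c) (hy : Continuous y)
    (hq : ∀ t ∈ Icc (0 : ℝ) s, q t = 0)
    (hode : ∀ t ∈ Icc (0 : ℝ) s, HasDerivWithinAt y (q t - c * y t) (Icc 0 s) t) :
    ∀ t ∈ Icc (0 : ℝ) s, y t ^ 2 ≤ y 0 ^ 2 := by
  intro t ht
  have hanti : AntitoneOn (fun u => y u * y u) (Icc 0 s) := by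
    apply antitoneOn_of_hasDerivWithinAt_nonpos (convex_Icc 0 s)
      (f' := fun u => (q u - c * y u) * y u + y u * (q u - c * y u))
    · exact (hy.mul hy).continuousOn
    · intro u hu
      have hd := (hode u (interior_subset hu)).mono (interior_subset (s := Icc (0 : ℝ) s))
      exact hd.mul hd
    · intro u hu
      have h0 : q u = 0 := hq u (interior_subset hu)
      have : 0 ≤ c * (y u * y u) := mul_nonneg hc (mul_self_nonneg _)
      rw [h0]
      nlinarith
  have := hanti ⟨le_refl 0, ht.1.trans ht.2⟩ ht ht.1
  simpa only [sq] using this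


/-- **ENVELOPE PULLBACK UNDER A RE-DRESSING (the BC8 «surgery invariance» tool).**  Let the tables
`α`, `α̃` be intertwined by the mode map `L` (identity `hQ`, for ALL amplitude families), let `D` be
a set of DEAD components of `α` (no structure constant targets them, `hD`), and suppose the shell
energy of `α` is dominated by the `S`-partial shell energy of the image plus the dead part (`hE`,
an inequality between quadratic forms on `ℝ^m`).  Then, for a fixed one-shell datum `X₀`, window
`[0, s]`, viscosity `ν ≥ 0` and constants `C`, `η`: if EVERY honest `ν`-viscous `α̃`-solution on
`[0, s]` from the datum `L X₀` has `S`-partial tail energies `≤ C (1+ε₀)^{-(1+η)n}`, then EVERY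
honest `ν`-viscous `α`-solution on `[0, s]` from `X₀` has TOTAL tail energies
`≤ (C + Σ_{c∈D} ½X₀(c)²)(1+ε₀)^{-(1+η)n}` (the dead components only carry their damped datum at
shell `0`).  This is exactly the shape of the solution clauses of `ForwardSourceTailEnvelope` (for
`α̃`, `S`) and of `ViscousTailEnvelope` (for `α`).  MODEL lattice statement; pure bookkeeping +
`sq_le_sq_init_of_damped`. [this file] -/
theorem envelope_pullback_of_redress {ν η C s : ℝ} (hε : -1 < ε₀) (hν : 0 ≤ ν)
    {α αt : Fin m → Fin m → Fin m → ℤ × ℤ × ℤ → ℝ} (L : Fin m → Fin m → ℝ) (S D : Finset (Fin m))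
    (hD : ∀ c ∈ D, ∀ (i₁ i₂ : Fin m), ∀ μ ∈ shiftSet, α i₁ i₂ c μ = 0)
    (hQ : ∀ (Y : Fin m → ℤ → ℝ → ℝ) (i : Fin m) (k : ℤ) (t : ℝ),
      quadTerm ε₀ αt (fun i k t => ∑ j, L i j * Y j k t) i k t = ∑ j, L i j * quadTerm ε₀ α Y j k t)
    (hE : ∀ v : Fin m → ℝ, ∑ i, (1 / 2 : ℝ) * v i ^ 2 ≤
      ∑ i ∈ S, (1 / 2 : ℝ) * (∑ j, L i j * v j) ^ 2 + ∑ c ∈ D, (1 / 2 : ℝ) * v c ^ 2)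
    (X₀ : Fin m → ℝ)
    (henv : ∀ Xt : Fin m → ℤ → ℝ → ℝ,
      (∀ i k, Xt i k 0 = if k = 0 then (∑ j, L i j * X₀ j) else 0) →
      (∀ i k, k < 0 → ∀ t, Xt i k t = 0) →
      (∃ M : ℝ, ∀ (t : ℝ) (i : Fin m) (k : ℤ), (1 + (1 + ε₀) ^ ((10 : ℝ) * k)) * |Xt i k t| ≤ M) →
      (∀ i k, Continuous (Xt i k)) →
      (∀ (i : Fin m) (k : ℤ), ∀ t ∈ Icc (0 : ℝ) s, HasDerivWithinAt (Xt i k)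
        (quadTerm ε₀ αt Xt i k t - ν * (1 + ε₀) ^ ((2 : ℝ) * k) * Xt i k t) (Icc 0 s) t) →
      ∀ n N : ℕ, n ≤ N → ∀ t ∈ Icc (0 : ℝ) s,
        ∑ k ∈ Finset.Icc n N, ∑ i ∈ S, (1 / 2 : ℝ) * Xt i (k : ℤ) t ^ 2 ≤
          C * (1 + ε₀) ^ (-((1 + η) * (n : ℝ)))) :
    ∀ X : Fin m → ℤ → ℝ → ℝ,
      (∀ i k, X i k 0 = if k = 0 then X₀ i else 0) →
      (∀ i k, k < 0 → ∀ t, X i k t = 0) →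
      (∃ M : ℝ, ∀ (t : ℝ) (i : Fin m) (k : ℤ), (1 + (1 + ε₀) ^ ((10 : ℝ) * k)) * |X i k t| ≤ M) →
      (∀ i k, Continuous (X i k)) →
      (∀ (i : Fin m) (k : ℤ), ∀ t ∈ Icc (0 : ℝ) s, HasDerivWithinAt (X i k)
        (quadTerm ε₀ α X i k t - ν * (1 + ε₀) ^ ((2 : ℝ) * k) * X i k t) (Icc 0 s) t) →
      ∀ n N : ℕ, n ≤ N → ∀ t ∈ Icc (0 : ℝ) s,
        ∑ k ∈ Finset.Icc n N, ∑ i, (1 / 2 : ℝ) * X i (k : ℤ) t ^ 2 ≤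
          (C + ∑ c ∈ D, (1 / 2 : ℝ) * X₀ c ^ 2) * (1 + ε₀) ^ (-((1 + η) * (n : ℝ))) := by
  intro X hinit hlow hbd hcont hode n N hnN t ht
  obtain ⟨Xt, hXt⟩ : ∃ Xt : Fin m → ℤ → ℝ → ℝ, ∀ i k t, Xt i k t = ∑ j, L i j * X j k t :=
    ⟨fun i k t => ∑ j, L i j * X j k t, fun _ _ _ => rfl⟩
  have hQ' : ∀ (i : Fin m) (k : ℤ), ∀ t ∈ Icc (0 : ℝ) s,
      quadTerm ε₀ αt Xt i k t = ∑ j, L i j * quadTerm ε₀ α X j k t := by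
    intro i k t _
    have hfun : Xt = fun i k t => ∑ j, L i j * X j k t :=
      funext fun i => funext fun k => funext fun t => hXt i k t
    rw [hfun]
    exact hQ X i k t
  have h1 := henv Xt (redress_init hXt (Xt₀ := fun i => ∑ j, L i j * X₀ j) (fun _ => rfl) hinit)
    (redress_noLow hXt hlow) (redress_bound hXt hbd) (redress_continuous hXt hcont)
    (redress_ode hXt hQ' hode) n N hnN t ht
  have hlam : 0 < 1 + ε₀ := by linarith
  -- the dead components only decay
  have hdead : ∀ c ∈ D, ∀ k : ℤ, X c k t ^ 2 ≤ X c k 0 ^ 2 := by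
    intro c hc k
    refine sq_le_sq_init_of_damped (q := fun u => quadTerm ε₀ α X c k u)
      (c := ν * (1 + ε₀) ^ ((2 : ℝ) * k)) (s := s)
      (mul_nonneg hν (Real.rpow_nonneg hlam.le _)) (hcont c k)
      (fun u _ => quadTerm_eq_zero_of_coeff_target (hD c hc) X k u) (fun u hu => hode c k u hu) t ht
  -- per-shell energy comparison
  have hshell : ∀ k : ℤ, ∑ i, (1 / 2 : ℝ) * X i k t ^ 2 ≤
      ∑ i ∈ S, (1 / 2 : ℝ) * Xt i k t ^ 2 +
        ∑ c ∈ D, (1 / 2 : ℝ) * (if k = 0 then X₀ c else 0) ^ 2 := by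
    intro k
    have hEk := hE (fun i => X i k t)
    simp only at hEk
    simp_rw [← hXt] at hEk
    refine hEk.trans (add_le_add (le_refl _) ?_)
    exact Finset.sum_le_sum fun c hc => by
      rw [← hinit c k]
      exact mul_le_mul_of_nonneg_left (hdead c hc k) (by norm_num)
  -- the dead part sums to at most its datum energy, and only when `n = 0`
  set A : ℝ := ∑ c ∈ D, (1 / 2 : ℝ) * X₀ c ^ 2 with hA_def
  have hA0 : 0 ≤ A := Finset.sum_nonneg fun c _ => by positivity
  have hin : ∀ k : ℕ, (∑ c ∈ D, (1 / 2 : ℝ) * (if ((k : ℤ)) = 0 then X₀ c else 0) ^ 2) =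
      if k = 0 then A else 0 := by
    intro k
    by_cases hk : k = 0
    · subst hk
      simp [hA_def]
    · simp [hk]
  have hdeadsum : ∑ k ∈ Finset.Icc n N, ∑ c ∈ D, (1 / 2 : ℝ) * (if ((k : ℕ) : ℤ) = 0 then X₀ c else 0) ^ 2
      ≤ A * (1 + ε₀) ^ (-((1 + η) * (n : ℝ))) := by
    rw [Finset.sum_congr rfl fun k _ => hin k, Finset.sum_ite_eq']
    split_ifs with h0
    · have hn : n = 0 := Nat.le_zero.mp (Finset.mem_Icc.mp h0).1
      subst hn
      simp
    · exact mul_nonneg hA0 (Real.rpow_nonneg hlam.le _)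
  calc ∑ k ∈ Finset.Icc n N, ∑ i, (1 / 2 : ℝ) * X i (k : ℤ) t ^ 2
      ≤ ∑ k ∈ Finset.Icc n N, (∑ i ∈ S, (1 / 2 : ℝ) * Xt i (k : ℤ) t ^ 2 +
          ∑ c ∈ D, (1 / 2 : ℝ) * (if ((k : ℕ) : ℤ) = 0 then X₀ c else 0) ^ 2) :=
        Finset.sum_le_sum fun k _ => hshell k
    _ = (∑ k ∈ Finset.Icc n N, ∑ i ∈ S, (1 / 2 : ℝ) * Xt i (k : ℤ) t ^ 2) +
          ∑ k ∈ Finset.Icc n N, ∑ c ∈ D, (1 / 2 : ℝ) * (if ((k : ℕ) : ℤ) = 0 then X₀ c else 0) ^ 2 :=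
        Finset.sum_add_distrib
    _ ≤ C * (1 + ε₀) ^ (-((1 + η) * (n : ℝ))) + A * (1 + ε₀) ^ (-((1 + η) * (n : ℝ))) :=
        add_le_add h1 hdeadsum
    _ = (C + A) * (1 + ε₀) ^ (-((1 + η) * (n : ℝ))) := by ring

end Redressing

end Summit.NavierStokesRegularity.NavierStokesRegularity.Theorems

end
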